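import Summits.HubbardSuperconductivity.HubbardSuperconductivity.Theorems.FunctionFieldCertificateMesoscopicPairOrderDanskin
import HarnessLib

/-!
# Crux `NoOnsiteODLRO` (stmt-HubbardSuperconductivity-0933) — Danskin's first-order upper bound for
# the gain of a matrix pencil on a sector

Helper file of line `Sketch` (lead c3) for the crux `NoOnsiteODLRO` (routes `LiebTwin`, `EnslavedA1g`),
serving the registered by-product stub `stub_pencilGainFirstOrder`: for matrices `H`, `Y` on a finite
index type, a sector `K ≠ ⊥` (`E_K = Matrix.minEnergyOn · K`, the infimum of `Re⟨φ, · φ⟩` over the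
unit vectors `φ` of `K`) and a real `M` with `Re⟨φ, Y φ⟩ ≤ M` for every unit MINIMISER `φ` of `H` on
`K` (`Re⟨φ, H φ⟩ = E_K(H)`), for every `η > 0` there is `c₀ > 0` with
`E_K(H) - E_K(H - c·Y) ≤ c·(M + η)` for all `0 < c ≤ c₀` — the right derivative at `0⁺` of the
(concave) gain `c ↦ E_K(H) - E_K(H - cY)` is at most `max_{minimisers} Re⟨φ, Y φ⟩` (degenerate
first-order perturbation theory, upper half; the mirror image of the tree's
`FunctionFieldCertificate.exists_chord_ge_of_forall_ground`, with the Rayleigh notion of ground state,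
so that neither hermiticity nor `H`-invariance of `K` is needed).

Proof without derivatives (`exists_forall_minEnergyOn_sub_le_re_rayleigh`): the unit vectors `φ ∈ K`
with `Re⟨φ, Y φ⟩ ≥ M + η` form a compact set
(`FunctionFieldCertificate.isCompact_unit_inter_re_rayleigh_le` for `-Y`) containing no minimiser, so
the continuous `Re⟨φ, H φ⟩` exceeds `E_K(H)` by some `d > 0` on it; as `Re⟨φ, Y φ⟩ ≤ Σ_{s,t}|Y_{st}|`
(`re_rayleigh_le_sum_norm`), every coupling `c ≤ d/(Σ|Y_{st}| + |M + η| + 1)` gives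
`Re⟨φ, (H - cY) φ⟩ ≥ E_K(H) - c(M + η)` there, while the remaining unit vectors of `K` satisfy it for
every `c > 0`; pass to the infimum (`pencilGainFirstOrder`).

Sources: J. M. Danskin, *The Theory of Max-Min* (1967) Ch. I; T. Kato, *Perturbation Theory for
Linear Operators* (1966) II §6.1 (and II §5.4, Thm 5.4); R. B. Griffiths, J. Math. Phys. 5 (1964)
1215 §III; H. Tasaki, *Physics and Mathematics of Quantum Many-Body Systems* (2020) §2.1. Folklore
finite-dimensional statements on tree definitions; no definition and no named fact is introduced.
-/

noncomputable section

set_option linter.dupNamespace false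

namespace Summit.HubbardSuperconductivity.HubbardSuperconductivity.Theorems.NoOnsiteODLRO.Danskin

open Matrix Finset
open Literature.Probability.LatticeModels Literature.MathematicalPhysics.QuantumLattice
open scoped ComplexOrder
open Summit.HubbardSuperconductivity.HubbardSuperconductivity.Theorems.FunctionFieldCertificate
  (isCompact_unit_inter_re_rayleigh_le)

section Abstract

variable {n : Type*} [Fintype n]

/-- Crude upper bound `Re⟨φ, Y φ⟩ ≤ Σ_{s,t} |Y_{st}|` for a unit vector (`neg_sum_norm_le_re_rayleigh`
for `-Y`). Tasaki (2020) §2.1; Kato, Perturbation Theory for Linear Operators (1966) II §6.1.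
[folklore] -/
theorem re_rayleigh_le_sum_norm (Y : Matrix n n ℂ) {φ : n → ℂ} (hφ : star φ ⬝ᵥ φ = 1) :
    (star φ ⬝ᵥ Y *ᵥ φ).re ≤ ∑ s, ∑ t, ‖Y s t‖ := by
  have h := neg_sum_norm_le_re_rayleigh (-Y) hφ
  have hsum : (∑ s, ∑ t, ‖(-Y) s t‖) = ∑ s, ∑ t, ‖Y s t‖ :=
    Finset.sum_congr rfl fun s _ => Finset.sum_congr rfl fun t _ => by
      rw [Matrix.neg_apply, norm_neg]
  rw [hsum, neg_mulVec, dotProduct_neg, Complex.neg_re] at h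
  linarith

/-- Real part of the Rayleigh quotient along the pencil `H - cY`, `c` real:
`Re⟨φ, (H - cY) φ⟩ = Re⟨φ, H φ⟩ - c·Re⟨φ, Y φ⟩`. Kato, Perturbation Theory for Linear Operators
(1966) II §6.1. [folklore] -/
theorem re_rayleigh_sub_real_smul (H Y : Matrix n n ℂ) (c : ℝ) (φ : n → ℂ) :
    (star φ ⬝ᵥ (H - (c : ℂ) • Y) *ᵥ φ).re =
      (star φ ⬝ᵥ H *ᵥ φ).re - c * (star φ ⬝ᵥ Y *ᵥ φ).re := by
  rw [sub_mulVec, smul_mulVec, dotProduct_sub, dotProduct_smul, Complex.sub_re, smul_eq_mul,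
    Complex.re_ofReal_mul]

/-- **Pointwise Danskin bound** (upper half of degenerate first-order perturbation theory, before
passing to the infimum). Let `H`, `Y` be ANY square matrices, `K` a subspace, and suppose every unit
vector `φ ∈ K` realising the sector energy (`Re⟨φ, H φ⟩ = E_K(H)`) has `Re⟨φ, Y φ⟩ ≤ M`. Then for
every `η > 0` there is `c₀ > 0` such that `E_K(H) - c(M + η) ≤ Re⟨φ, H φ⟩ - c·Re⟨φ, Y φ⟩` for all
`0 < c ≤ c₀` and all unit `φ ∈ K`. Proof: the unit vectors `φ ∈ K` with `Re⟨φ, Y φ⟩ ≥ M + η` form a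
compact set (`isCompact_unit_inter_re_rayleigh_le` for `-Y`) free of minimisers, so the continuous
`Re⟨φ, H φ⟩` is `≥ E_K(H) + d` on it for some `d > 0`; with `Re⟨φ, Y φ⟩ ≤ Σ|Y_{st}|`
(`re_rayleigh_le_sum_norm`) the threshold `c₀ = d/(Σ|Y_{st}| + |M + η| + 1)` works there, and the
other unit vectors of `K` satisfy the bound for every `c > 0`. Danskin, The Theory of Max-Min (1967)
Ch. I; Kato, Perturbation Theory for Linear Operators (1966) II §6.1. [folklore] -/
theorem exists_forall_minEnergyOn_sub_le_re_rayleigh (H Y : Matrix n n ℂ) (K : Submodule ℂ (n → ℂ))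
    {M η : ℝ} (hη : 0 < η)
    (hground : ∀ φ ∈ K, star φ ⬝ᵥ φ = 1 → (star φ ⬝ᵥ H *ᵥ φ).re = H.minEnergyOn K →
      (star φ ⬝ᵥ Y *ᵥ φ).re ≤ M) :
    ∃ c₀ : ℝ, 0 < c₀ ∧ ∀ c : ℝ, 0 < c → c ≤ c₀ → ∀ φ ∈ K, star φ ⬝ᵥ φ = 1 →
      H.minEnergyOn K - c * (M + η) ≤ (star φ ⬝ᵥ H *ᵥ φ).re - c * (star φ ⬝ᵥ Y *ᵥ φ).re := by
  set E : ℝ := H.minEnergyOn K with hE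
  set B : ℝ := ∑ s, ∑ t, ‖Y s t‖ with hB
  have hB0 : 0 ≤ B := Finset.sum_nonneg fun s _ => Finset.sum_nonneg fun t _ => norm_nonneg _
  -- the bad set: unit vectors of `K` with `Re⟨φ, Y φ⟩ ≥ M + η`, written with `-Y`
  set S : Set (n → ℂ) :=
    {φ | star φ ⬝ᵥ φ = 1 ∧ φ ∈ K ∧ (star φ ⬝ᵥ (-Y) *ᵥ φ).re ≤ -(M + η)} with hS
  have hScpt : IsCompact S := isCompact_unit_inter_re_rayleigh_le (-Y) K (-(M + η))
  have hneg : ∀ φ : n → ℂ, (star φ ⬝ᵥ (-Y) *ᵥ φ).re = -(star φ ⬝ᵥ Y *ᵥ φ).re := fun φ => by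
    rw [neg_mulVec, dotProduct_neg, Complex.neg_re]
  have hcontH : Continuous fun φ : n → ℂ => (star φ ⬝ᵥ H *ᵥ φ).re :=
    Complex.continuous_re.comp
      (continuous_star.dotProduct (continuous_const.matrix_mulVec continuous_id))
  by_cases hSne : S.Nonempty
  · obtain ⟨φ₀, hφ₀S, hmin⟩ := hScpt.exists_isMinOn hSne hcontH.continuousOn
    obtain ⟨h01, h0K, h0Y⟩ := hφ₀S
    rw [hneg] at h0Y
    -- the minimum over the bad set lies strictly above the sector energy
    have hd : E < (star φ₀ ⬝ᵥ H *ᵥ φ₀).re := by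
      rcases (minEnergyOn_le_re_rayleigh H K h0K h01).lt_or_eq with hlt | heq
      · exact hlt
      · exfalso
        have := hground φ₀ h0K h01 heq.symm
        linarith
    set d : ℝ := (star φ₀ ⬝ᵥ H *ᵥ φ₀).re - E with hd'
    have hdpos : 0 < d := by rw [hd']; linarith
    refine ⟨d / (B + |M + η| + 1), by positivity, fun c hc hcc₀ φ hφK hφ => ?_⟩
    have hEφ := minEnergyOn_le_re_rayleigh H K hφK hφ
    by_cases hbad : M + η ≤ (star φ ⬝ᵥ Y *ᵥ φ).re
    · have hφS : φ ∈ S := by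
        refine ⟨hφ, hφK, ?_⟩
        show (star φ ⬝ᵥ (-Y) *ᵥ φ).re ≤ -(M + η)
        rw [hneg]
        linarith
      have h1 : (star φ₀ ⬝ᵥ H *ᵥ φ₀).re ≤ (star φ ⬝ᵥ H *ᵥ φ).re := hmin hφS
      have h2 := re_rayleigh_le_sum_norm Y hφ
      have h3 : d / (B + |M + η| + 1) * (B + |M + η| + 1) = d := by
        field_simp
      have h4 : -(M + η) ≤ |M + η| := neg_le_abs _
      have h5 : c * (B + |M + η| + 1) ≤ d := by
        calc c * (B + |M + η| + 1) ≤ d / (B + |M + η| + 1) * (B + |M + η| + 1) :=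
              mul_le_mul_of_nonneg_right hcc₀ (by positivity)
          _ = d := h3
      linarith [mul_le_mul_of_nonneg_left h2 hc.le, mul_le_mul_of_nonneg_left h4 hc.le]
    · push Not at hbad
      linarith [mul_le_mul_of_nonneg_left hbad.le hc.le]
  · refine ⟨1, one_pos, fun c hc _ φ hφK hφ => ?_⟩
    have hEφ := minEnergyOn_le_re_rayleigh H K hφK hφ
    have hgood : (star φ ⬝ᵥ Y *ᵥ φ).re < M + η := by
      by_contra hcon
      push Not at hcon
      refine hSne ⟨φ, hφ, hφK, ?_⟩
      show (star φ ⬝ᵥ (-Y) *ᵥ φ).re ≤ -(M + η)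
      rw [hneg]
      linarith
    linarith [mul_le_mul_of_nonneg_left hgood.le hc.le]

/-- **Danskin's first-order upper bound for the gain of a pencil on a sector** (hypothesis form).
Let `H`, `Y` be ANY square matrices, `K ≠ ⊥` a subspace and `M` a real number such that every unit
vector `φ ∈ K` with `Re⟨φ, H φ⟩ = E_K(H)` has `Re⟨φ, Y φ⟩ ≤ M`. Then for every `η > 0` there is
`c₀ > 0` with `E_K(H) - E_K(H - c·Y) ≤ c·(M + η)` for all `0 < c ≤ c₀`: the pointwise bound
`exists_forall_minEnergyOn_sub_le_re_rayleigh` passed to the infimum over the (nonempty) unit sphere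
of `K`. This is the upper half of "`∂⁺_c E_K(H - cY)|₀ = -max_{minimisers} Re⟨φ, Y φ⟩`".
Danskin, The Theory of Max-Min (1967) Ch. I; Kato, Perturbation Theory for Linear Operators (1966)
II §6.1. [folklore] -/
theorem pencilGainFirstOrder (H Y : Matrix n n ℂ) {K : Submodule ℂ (n → ℂ)} (hK : K ≠ ⊥) {M η : ℝ}
    (hη : 0 < η)
    (hground : ∀ φ ∈ K, star φ ⬝ᵥ φ = 1 → (star φ ⬝ᵥ H *ᵥ φ).re = H.minEnergyOn K →
      (star φ ⬝ᵥ Y *ᵥ φ).re ≤ M) :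
    ∃ c₀ : ℝ, 0 < c₀ ∧ ∀ c : ℝ, 0 < c → c ≤ c₀ →
      H.minEnergyOn K - (H - (c : ℂ) • Y).minEnergyOn K ≤ c * (M + η) := by
  obtain ⟨c₀, hc₀, hall⟩ := exists_forall_minEnergyOn_sub_le_re_rayleigh H Y K hη hground
  refine ⟨c₀, hc₀, fun c hc hcc₀ => ?_⟩
  obtain ⟨w, hwK, hw0⟩ := Submodule.exists_mem_ne_zero_of_ne_bot hK
  obtain ⟨a, -, ha1⟩ := exists_smul_unit hw0
  rw [sub_le_comm]
  refine le_csInf ⟨_, a • w, K.smul_mem a hwK, ha1, rfl⟩ ?_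
  rintro e ⟨φ, hφK, hφ, rfl⟩
  rw [re_rayleigh_sub_real_smul]
  exact hall c hc hcc₀ φ hφK hφ

end Abstract

/-- **`stub_pencilGainFirstOrder`** (registered by-product stub of crux `NoOnsiteODLRO`, line `Sketch`, in
its exact registered form): for Hermitian `H`, `Y` on a finite index type (hermiticity is not used), a
sector `K ≠ ⊥` and a real `M` bounding `Re⟨φ, Y φ⟩` over all unit minimisers `φ` of `H` on `K`, for
every `η > 0` there is `c₀ > 0` with `E_K(H) - E_K(H - c·Y) ≤ c·(M + η)` for all `0 < c ≤ c₀`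
(`pencilGainFirstOrder`). Danskin, The Theory of Max-Min (1967) Ch. I; Kato, Perturbation Theory for
Linear Operators (1966) II §6.1. [folklore] -/
theorem stub_pencilGainFirstOrder :
    ∀ (m : Type) [Fintype m] [DecidableEq m] (H Y : Matrix m m ℂ), H.IsHermitian → Y.IsHermitian →
      ∀ (K : Submodule ℂ (m → ℂ)), K ≠ ⊥ →
        ∀ M : ℝ,
          (∀ φ ∈ K, star φ ⬝ᵥ φ = 1 → (star φ ⬝ᵥ H *ᵥ φ).re = H.minEnergyOn K →
              (star φ ⬝ᵥ Y *ᵥ φ).re ≤ M) →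
            ∀ η : ℝ, 0 < η → ∃ c₀ : ℝ, 0 < c₀ ∧ ∀ c : ℝ, 0 < c → c ≤ c₀ →
              H.minEnergyOn K - (H - (c : ℂ) • Y).minEnergyOn K ≤ c * (M + η) :=
  fun _ _ _ H Y _ _ _ hK _ hground _ hη => pencilGainFirstOrder H Y hK hη hground

end Summit.HubbardSuperconductivity.HubbardSuperconductivity.Theorems.NoOnsiteODLRO.Danskin
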